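import Literature.Topology.FourManifolds.TrisectionsH23Critical
import Literature.Topology.FourManifolds.TrisectionsHeegaardGerm
import Literature.Topology.FourManifolds.MorseAffine
import Literature.Topology.FourManifolds.SPC4HandleChainProofs
import Literature.Topology.FourManifolds.GradientFlowLimits
import HarnessLib

/-!
# The Morse function of the handlebody `H₂₃`, IV: the lid critical points and the critical
# points of the Heegaard function

Topic `Literature/Topology/FourManifolds`; infrastructure for the fact seat
`provefact-Literature.Topology.FourManifolds.exists_isBalancedGKTrisection` (Gay–Kirby 2016,
Thm. 4 via §4, Lemma 14), continuing `TrisectionsH23Critical.lean`.  Everything in this file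
is **proved**; no named facts are introduced.

This file relates the lid critical points of `F_H` (hitting points of `H₂₃` off the core zones,
`TrisectionsH23Regular.lean`) to the critical points of the Heegaard function `g` on the level
`Y = f⁻¹(a)`:

* `TubeFrame.exists_f_flow_eq_c_or_mem_stableSet` — **forward reach**: the trajectory of a
  point of `Y` reaches the lid level `c`, unless the point lies on the attaching circle of one
  of the `2`-handles (the forward limit is a critical point with value in `(a, c]`, i.e. one of
  the box centres; Milnor 1965, Thm. 3.4 / proof of Thm. 3.12);
* `TubeFrame.tubeNbhd` — the thin tube `{P_j < P₀}` of the `j`-th circle in `Y`, on which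
  `g = k_g 𝒯(coord_j) + g₀`; `TubeFrame.isMCriticalPt_g_iff_of_mem_tubeNbhd` — there the
  critical points of `g` are the four axis points of the circle
  (`HeegaardGerm.isMCriticalPt_comp_incl_iff`), which lie on the stable set of the centre
  (`TubeFrame.mem_stableSet_of_isMCriticalPt_of_mem_tubeNbhd`);
* `BeltParams.lamLift_mem_critY` / `exists_lid_of_mem_critY` / `lamLift_injOn` — the landing
  map `λ` is a bijection from the lid critical points of `F_H` of index `i` onto the critical
  points of `g` of index `i` below `b` off the thin tubes (`BeltParams.ncard_lidCrit_eq`).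

## References

* D. Gay, R. Kirby, *Trisecting 4-manifolds*, Geom. Topol. 20 (2016), §4, Lemma 14. [GayKirby2016]
* J. Milnor, *Lectures on the h-cobordism theorem* (1965), Def. 3.1, Thm. 3.4, proof of
  Thm. 3.12, Thm. 4.1. [MilnorHCobordism1965]
* J. Milnor, *Morse theory* (1963), §2–§3. [Milnor1963]
-/

open scoped Manifold ContDiff Topology
open Set Function Filter

noncomputable section

universe u

namespace Literature.Topology.FourManifolds

open Flow

variable {X : Type u} [TopologicalSpace X] [T2Space X] [CompactSpace X]
  [ChartedSpace (EuclideanSpace ℝ (Fin 4)) X] [IsManifold (𝓡 4) ∞ X]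

namespace BiCollar

namespace TriData

namespace TubeFrame

variable {B : BiCollar X} {T : B.TriData} {ι : Type} [Fintype ι] (𝔉 : T.TubeFrame ι) {j : ι}

/-! ### Forward reach of the lid level -/

/-- **Forward reach.**  The trajectory of a point `y` of the level `Y = f⁻¹(a)` reaches the lid
level `f = c`, or `y` lies on a trajectory going to one of the centres `c_j` of the `2`-handle
boxes (the forward limit of the trajectory is a critical point with value in `(a, c]`, hence a
`c_j`). [cite: MilnorHCobordism1965, Thm. 3.4 and proof of Thm. 3.12 (PDF pp. 13, 18)] -/
theorem exists_f_flow_eq_c_or_mem_stableSet (y : B.Y) :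
    (∃ t, B.f (flow B.U.contMDiff y.1 t) = T.c) ∨ ∃ j, y.1 ∈ stableSet (𝓡 4) B.U.ξ (𝔉.boxes.cpt j) := by
  by_cases hh : ∃ t, B.f (flow B.U.contMDiff y.1 t) = T.c
  · exact Or.inl hh
  right
  push Not at hh
  have hgl := T.Fr.isGradientLike
  have hfM := T.Fr.isMorse
  have hya : B.f y.1 = B.a := y.2
  have hyc : ¬ IsMCriticalPt (𝓡 4) B.f y.1 := B.not_isMCriticalPt_of_apply_eq_a hya
  have hmono : StrictMono (B.f ∘ flow B.U.contMDiff y.1) := hgl.strictMono_comp_flow hfM B.U.contMDiff hyc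
  have hcont : Continuous B.f := B.U.contMDiff_f.continuous
  have hac := 𝔉.a_lt_c
  -- `f < c` along the orbit
  have hlt : ∀ t, B.f (flow B.U.contMDiff y.1 t) < T.c := by
    intro t
    by_contra hle
    push Not at hle
    rcases le_or_gt t 0 with ht | ht
    · have h := hmono.monotone ht
      simp only [comp_apply, flow_zero] at h
      linarith
    · have hcont' : ContinuousOn (fun r => B.f (flow B.U.contMDiff y.1 r)) (Icc 0 t) :=
        (hcont.comp (continuous_flow B.U.contMDiff y.1)).continuousOn
      obtain ⟨r, -, hr⟩ := intermediate_value_Icc ht.le hcont' ⟨by rw [flow_zero, hya]; exact hac.le, hle⟩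
      exact hh r hr
  obtain ⟨r, hrcrit, hrlim⟩ := hgl.exists_isMCriticalPt_tendsto_flow_atTop hfM B.U.contMDiff y.1
  have hflim : Tendsto (fun t => B.f (flow B.U.contMDiff y.1 t)) atTop (𝓝 (B.f r)) := (hcont.tendsto r).comp hrlim
  have hr₂ : B.f r ≤ T.c := le_of_tendsto' hflim fun t => (hlt t).le
  have hr₁ : B.a < B.f r := by
    have h1 : B.a < B.f (flow B.U.contMDiff y.1 1) := by
      have h := hmono (zero_lt_one' ℝ)
      simp only [comp_apply, flow_zero, hya] at h
      exact h
    have hev : ∀ᶠ t in atTop, B.f (flow B.U.contMDiff y.1 1) ≤ B.f (flow B.U.contMDiff y.1 t) :=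
      (eventually_ge_atTop (1 : ℝ)).mono fun t ht => hmono.monotone ht
    exact lt_of_lt_of_le h1 (ge_of_tendsto hflim hev)
  obtain ⟨j, hj⟩ := 𝔉.boxes.crit_val r hrcrit (by linarith [𝔉.η₂_pos]) (by linarith [𝔉.c_lt])
  refine ⟨j, ?_⟩
  rw [stableSet_eq_setOf_tendsto B.U.contMDiff]
  show Tendsto (flow B.U.contMDiff y.1) atTop (𝓝 (𝔉.boxes.cpt j))
  rw [← hj]; exact hrlim

/-- A point of the level on a trajectory going to `c_j` stays below `f c_j = a + η₂ < c` along
its whole orbit: its orbit never reaches the lid level. [cite: MilnorHCobordism1965, Def. 3.9 (PDF p. 16)] -/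
theorem f_flow_lt_c_of_mem_stableSet {y : X} (hy : y ∈ stableSet (𝓡 4) B.U.ξ (𝔉.boxes.cpt j)) (t : ℝ) :
    B.f (flow B.U.contMDiff y t) < T.c := by
  have hgl := T.Fr.isGradientLike
  have hf : MDifferentiable (𝓡 4) 𝓘(ℝ, ℝ) B.f := B.U.contMDiff_f.mdifferentiable (by simp)
  have hyt : flow B.U.contMDiff y t ∈ stableSet (𝓡 4) B.U.ξ (𝔉.boxes.cpt j) := by
    rw [stableSet_eq_setOf_tendsto B.U.contMDiff] at hy ⊢
    have h : Tendsto (flow B.U.contMDiff y) atTop (𝓝 (𝔉.boxes.cpt j)) := hy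
    show Tendsto (flow B.U.contMDiff (flow B.U.contMDiff y t)) atTop (𝓝 (𝔉.boxes.cpt j))
    have hfun : flow B.U.contMDiff (flow B.U.contMDiff y t) = fun s => flow B.U.contMDiff y (t + s) :=
      funext fun s => (flow_add B.U.contMDiff y t s).symm
    rw [hfun]
    exact h.comp (tendsto_atTop_add_const_left atTop t tendsto_id)
  have hle := apply_le_of_mem_stableSet hf hgl.mlineDeriv_pos hyt
  rw [𝔉.boxes.apply_cpt j] at hle
  linarith [𝔉.c_eq, 𝔉.ν_pos, sq_nonneg 𝔉.ν, mul_pos 𝔉.ν_pos 𝔉.ν_pos]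

/-! ### The thin tubes of the attaching circles in the level -/

/-- **The thin tube of the `j`-th attaching circle in `Y`**: `{y ∈ Y | y ∈ source_j, P_j y < P₀}`.
[cite: GayKirby2016, §4, Lemma 14] -/
def tubeNbhd (j : ι) : Set B.Y :=
  {y | RegularLevel.incl B.hf y ∈ (𝔉.boxes.box j).chart.source ∧ 𝔉.boxes.P j (RegularLevel.incl B.hf y) < 𝔉.P₀}

omit [T2Space X] [CompactSpace X] in
/-- Membership in the thin tube. [folklore] -/
theorem mem_tubeNbhd {y : B.Y} :
    y ∈ 𝔉.tubeNbhd j ↔ y.1 ∈ (𝔉.boxes.box j).chart.source ∧ 𝔉.boxes.P j y.1 < 𝔉.P₀ := Iff.rfl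

omit [T2Space X] [CompactSpace X] in
/-- The thin tube is open in `Y`. [folklore] -/
theorem isOpen_tubeNbhd (j : ι) : IsOpen (𝔉.tubeNbhd j) := by
  have h : IsOpen {x : X | x ∈ (𝔉.boxes.box j).chart.source ∧ 𝔉.boxes.P j x < 𝔉.P₀} :=
    (𝔉.boxes.continuousOn_P j).isOpen_inter_preimage (𝔉.boxes.box j).chart.open_source isOpen_Iio
  exact h.preimage continuous_subtype_val

omit [T2Space X] [CompactSpace X] in
/-- The thin tubes are pairwise disjoint. [folklore] -/
theorem tubeNbhd_disjoint {i j : ι} (hij : i ≠ j) : Disjoint (𝔉.tubeNbhd i) (𝔉.tubeNbhd j) :=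
  Set.disjoint_left.2 fun _ hi hj => Set.disjoint_left.1 (𝔉.boxes.disjoint hij) hi.1 hj.1

/-- **The tube function of the `j`-th box** as a function on `X`: `𝒯(e x - e c_j)`. [cite: GayKirby2016, §4, Lemma 14] -/
def Ftube (j : ι) (x : X) : ℝ :=
  TubeModel.tube 𝔉.εT 𝔉.κT 𝔉.η₂ ((𝔉.boxes.box j).chart x - (𝔉.boxes.box j).chart (𝔉.boxes.cpt j))

omit [T2Space X] [CompactSpace X] in
/-- `f = f c_j + Q₂(e - e c_j)` on the chart domain (Milnor's coordinates of index `2`). [cite: MilnorHCobordism1965, Def. 3.1] -/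
theorem f_eq_add_milnorQuadratic (j : ι) :
    ∀ q ∈ (𝔉.boxes.box j).chart.source,
      B.f q = B.f (𝔉.boxes.cpt j) + milnorQuadratic 2 ((𝔉.boxes.box j).chart q - (𝔉.boxes.box j).chart (𝔉.boxes.cpt j)) := by
  intro q hq
  have h := (𝔉.boxes.box j).apply_eq q hq
  rw [𝔉.boxes.k_eq j] at h
  simpa [OpenPartialHomeomorph.extend_coe] using h

omit [T2Space X] [CompactSpace X] in
/-- **On the thin tube, `g = k_g 𝒯 + g₀`** (as germs). [cite: GayKirby2016, §4, Lemma 14] -/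
theorem g_eventuallyEq_of_mem_tubeNbhd {y : B.Y} (hy : y ∈ 𝔉.tubeNbhd j) :
    B.g =ᶠ[𝓝 y] fun y' => 𝔉.kg * (𝔉.Ftube j ∘ RegularLevel.incl B.hf) y' + 𝔉.g₀ := by
  filter_upwards [(𝔉.isOpen_tubeNbhd j).mem_nhds hy] with y' hy'
  rw [𝔉.g_tube j y' hy'.1 hy'.2, comp_apply, Ftube, 𝔉.coord_eq_sub hy'.1]

omit [T2Space X] [CompactSpace X] in
/-- **The critical points of `g` on the thin tube are the four axis points** of the attaching
circle: `u₂ = u₃ = 0`, `u₀ u₁ = 0` for `u = e y - e c_j` (`ε_T ≠ 0`). [cite: GayKirby2016, §4, Lemma 14] -/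
theorem isMCriticalPt_g_iff_of_mem_tubeNbhd (hεT : 0 < 𝔉.εT) {y : B.Y} (hy : y ∈ 𝔉.tubeNbhd j) :
    IsMCriticalPt (𝓡 3) B.g y ↔
      ((𝔉.boxes.box j).chart y.1 - (𝔉.boxes.box j).chart (𝔉.boxes.cpt j)) 2 = 0 ∧
      ((𝔉.boxes.box j).chart y.1 - (𝔉.boxes.box j).chart (𝔉.boxes.cpt j)) 3 = 0 ∧
      ((𝔉.boxes.box j).chart y.1 - (𝔉.boxes.box j).chart (𝔉.boxes.cpt j)) 0 *
        ((𝔉.boxes.box j).chart y.1 - (𝔉.boxes.box j).chart (𝔉.boxes.cpt j)) 1 = 0 := by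
  have he := (𝔉.boxes.box j).mem_maximalAtlas
  have hfe := 𝔉.f_eq_add_milnorQuadratic j
  have ha : B.a < B.f (𝔉.boxes.cpt j) := by rw [𝔉.boxes.apply_cpt j]; linarith [𝔉.η₂_pos]
  have hκ : 𝔉.κT / 𝔉.η₂ ≠ 0 := (div_pos 𝔉.κT_pos 𝔉.η₂_pos).ne'
  have hF : 𝔉.Ftube j =ᶠ[𝓝 y.1] fun q => TubeModel.tube 𝔉.εT 𝔉.κT 𝔉.η₂
      ((𝔉.boxes.box j).chart q - (𝔉.boxes.box j).chart (𝔉.boxes.cpt j)) := EventuallyEq.rfl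
  have hz := HeegaardGerm.nsq_proj_ne_zero (h := B.hf) hfe ha y hy.1
  have hFc : ContMDiffAt (𝓡 4) 𝓘(ℝ, ℝ) ∞ (𝔉.Ftube j) y.1 := HeegaardGerm.contMDiffAt_of_eventuallyEq he hy.1 hz hF
  have hd : MDifferentiableAt (𝓡 3) 𝓘(ℝ, ℝ) (𝔉.Ftube j ∘ RegularLevel.incl B.hf) y :=
    ((hFc.comp y (RegularLevel.contMDiff_incl B.hf y))).mdifferentiableAt (by simp)
  have hev : B.g =ᶠ[𝓝 y] fun y' => (fun y' => 𝔉.kg * (𝔉.Ftube j ∘ RegularLevel.incl B.hf) y' + 𝔉.g₀) y' + 0 :=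
    (𝔉.g_eventuallyEq_of_mem_tubeNbhd hy).trans (Eventually.of_forall fun _ => (add_zero _).symm)
  rw [isMCriticalPt_congr_of_eventuallyEq_add_const hev, isMCriticalPt_const_mul_add_iff 𝔉.kg_pos.ne' 𝔉.g₀ hd]
  exact HeegaardGerm.isMCriticalPt_comp_incl_iff he hfe ha hεT.ne' hκ y hy.1 hF

omit [T2Space X] [CompactSpace X] in
/-- **On the thin tube the level is `{|x⃗|² = η₂ + |y⃗|²}`**: `A_j y = η₂ + B_j y`. [cite: MilnorHCobordism1965, Def. 3.1] -/
theorem A_eq_of_level (y : B.Y) (hy : y.1 ∈ (𝔉.boxes.box j).chart.source) :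
    𝔉.boxes.A j y.1 = 𝔉.η₂ + 𝔉.boxes.B j y.1 := by
  have h := 𝔉.boxes.apply_eq hy
  have hya : B.f y.1 = B.a := y.2
  linarith

/-- **A critical point of `g` in the thin tube lies on the attaching circle** (`y⃗ = 0`), hence on
a trajectory going to the centre. [cite: MilnorHCobordism1965, proof of Thm. 3.12 and Thm. 3.13] -/
theorem mem_stableSet_of_isMCriticalPt_of_mem_tubeNbhd (hεT : 0 < 𝔉.εT) {y : B.Y} (hy : y ∈ 𝔉.tubeNbhd j)
    (hc : IsMCriticalPt (𝓡 3) B.g y) : y.1 ∈ stableSet (𝓡 4) B.U.ξ (𝔉.boxes.cpt j) := by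
  obtain ⟨h2, h3, -⟩ := (𝔉.isMCriticalPt_g_iff_of_mem_tubeNbhd hεT hy).1 hc
  have hu : (𝔉.boxes.box j).coord y.1 = (𝔉.boxes.box j).chart y.1 - (𝔉.boxes.box j).chart (𝔉.boxes.cpt j) :=
    𝔉.coord_eq_sub hy.1
  have hB : sqSumGE (𝔉.boxes.box j).k ((𝔉.boxes.box j).coord y.1) = 0 := by
    rw [𝔉.boxes.k_eq j, sqSumGE_two_apply, hu, h2, h3]; ring
  have hA : sqSumLT (𝔉.boxes.box j).k ((𝔉.boxes.box j).coord y.1) < (𝔉.boxes.box j).ε ^ 2 := by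
    have hAeq := 𝔉.A_eq_of_level y hy.1
    rw [HandleBoxes.A_def, HandleBoxes.B_def, hB, add_zero] at hAeq
    rw [hAeq]; linarith [𝔉.boxes.eta_lt j, 𝔉.η₂_pos]
  have h := MilnorBox.mem_stableSet_of_coord 𝔉.hζ (𝔉.boxes.box j) hy.1 hB hA
  rw [stableSet_smul_eq 𝔉.hζ B.U.contMDiff 𝔉.U_eq 𝔉.continuous_ρU 𝔉.ρU_pos]
  exact h

/-- **The landing point of a hitting point of a thin tube lies in the thin tube** (the box
coordinates' `P_j` is a first integral along the tube). [cite: MilnorHCobordism1965, proof of Thm. 3.12; Thm. 4.1] -/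
theorem lamLift_mem_tubeNbhd {x : X} (hsrc : x ∈ (𝔉.boxes.box j).chart.source) (hP : 𝔉.boxes.P j x < 𝔉.P₀)
    (hf₁ : B.a - 𝔉.η₂ < B.f x) (hf₂ : B.f x < B.a + 2 * 𝔉.η₂) (hx : B.Hit x) :
    B.lamLift x ∈ 𝔉.tubeNbhd j := by
  have hx' := (𝔉.hit_iff x).1 hx
  have hP' : 𝔉.boxes.P j x < 2 * (𝔉.P₀ / 2) := by linarith
  obtain ⟨hmem, hPeq, -⟩ := 𝔉.boxes.exists_levelProj_mem (hξ := 𝔉.hζ) 𝔉.hgl T.Fr.isMorse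
    (show 2 * (𝔉.P₀ / 2) ≤ 𝔉.η₂ ^ 2 by linarith [𝔉.P₀_le]) hsrc hP' hf₁ hf₂ hx'
  refine ⟨?_, ?_⟩
  · rw [𝔉.incl_lamLift_eq hx]; exact hmem
  · rw [𝔉.incl_lamLift_eq hx, hPeq]; exact hP

/-- **The critical points of `g` of index `i` below `b` off the thin tubes** — the landing points
of the lid critical points of `F_H` of index `i`. [cite: GayKirby2016, §4, Lemma 14] -/
def critY (i : ℕ) : Set B.Y :=
  {y | y ∈ criticalSetOfIndex (𝓡 3) B.g i ∧ B.g y < B.b ∧ ∀ j, y ∉ 𝔉.tubeNbhd j}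

omit [T2Space X] [CompactSpace X] in
/-- Membership in `critY`. [folklore] -/
theorem mem_critY {i : ℕ} {y : B.Y} :
    y ∈ 𝔉.critY i ↔ (IsMCriticalPt (𝓡 3) B.g y ∧ morseIndex (𝓡 3) B.g y = i) ∧ B.g y < B.b ∧ ∀ j, y ∉ 𝔉.tubeNbhd j :=
  Iff.rfl

/-- A point of the level on an attaching circle lies in the thin tube (it is a point of the
left-hand sphere of the box: `B_j = 0`, `A_j = η₂`, `P_j = 0`). [cite: MilnorHCobordism1965, proof of Thm. 3.12 and Thm. 3.13 (PDF pp. 18–19)] -/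
theorem mem_tubeNbhd_of_mem_stableSet {y : B.Y} (hy : y.1 ∈ stableSet (𝓡 4) B.U.ξ (𝔉.boxes.cpt j)) :
    y ∈ 𝔉.tubeNbhd j := by
  rw [stableSet_smul_eq 𝔉.hζ B.U.contMDiff 𝔉.U_eq 𝔉.continuous_ρU 𝔉.ρU_pos] at hy
  have hfy : B.f y.1 = B.f (𝔉.boxes.cpt j) - 𝔉.η₂ := by rw [𝔉.boxes.apply_cpt j, y.2]; ring
  obtain ⟨hsrc, hB, -⟩ := MilnorBox.coord_of_mem_stableSet_of_apply_eq 𝔉.hζ 𝔉.hgl T.Fr.isMorse (𝔉.boxes.box j)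
    𝔉.η₂_pos (by linarith [𝔉.boxes.eta_lt j, 𝔉.η₂_pos]) hy hfy
  refine ⟨hsrc, ?_⟩
  rw [HandleBoxes.P_def, HandleBoxes.B_def, hB, mul_zero]
  exact 𝔉.P₀_pos

/-- **A point of `critY` reaches the lid**: its trajectory meets the level `f = c`. [cite: MilnorHCobordism1965, Thm. 3.4] -/
theorem exists_f_flow_eq_c_of_mem_critY {i : ℕ} {y : B.Y} (hy : y ∈ 𝔉.critY i) :
    ∃ t, B.f (flow B.U.contMDiff y.1 t) = T.c := by
  rcases 𝔉.exists_f_flow_eq_c_or_mem_stableSet y with h | ⟨j, hj⟩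
  · exact h
  · exact absurd (𝔉.mem_tubeNbhd_of_mem_stableSet hj) (hy.2.2 j)

namespace BeltParams

variable {𝔉} (𝔓 : 𝔉.BeltParams) (hc2 : B.a + B.U.δ + 2 * T.ε ≤ T.c)

/-- **The lid part of the critical set of `F_H` of index `i`**: the critical points of index `i`
off the bi-collar box and off the core zones (they hit the level and lie on the flat lid).
[cite: GayKirby2016, §4, Lemma 14] -/
def lidCrit (i : ℕ) : Set T.H₂₃ :=
  {p | p.1 ∉ B.box T.D.εw ∧ (∀ j, p.1 ∉ 𝔓.zone j) ∧
    letI := (T.bsliceAtlas hc2 𝔉.two_mul_ε_le 𝔉.linkCondition).chartedSpace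
    p ∈ criticalSetOfIndex (𝓡∂ 3) 𝔓.FH i}

/-- Membership in `lidCrit`. [folklore] -/
theorem mem_lidCrit {i : ℕ} {p : T.H₂₃} :
    p ∈ 𝔓.lidCrit hc2 i ↔ p.1 ∉ B.box T.D.εw ∧ (∀ j, p.1 ∉ 𝔓.zone j) ∧
      letI := (T.bsliceAtlas hc2 𝔉.two_mul_ε_le 𝔉.linkCondition).chartedSpace
      IsMCriticalPt (𝓡∂ 3) 𝔓.FH p ∧ morseIndex (𝓡∂ 3) 𝔓.FH p = i :=
  Iff.rfl

include hc2 in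
/-- A point of `H₂₃` off the box and off the zones lies off the surface, off `X₁`, and hits. [folklore] -/
theorem hit_of_not_mem_box {p : T.H₂₃} (hb : p.1 ∉ B.box T.D.εw) (hz : ∀ j, p.1 ∉ 𝔓.zone j) :
    p.1 ∉ B.surface ∧ p.1 ∉ T.X₁ ∧ B.Hit p.1 := by
  have hps : p.1 ∉ B.surface := fun hs => hb (B.mem_box_of_mem_surface T.D.εw_pos hs)
  have hp₁ : p.1 ∉ T.X₁ := T.not_mem_X₁_of_mem_H₂₃_of_not_mem_box hc2 p.2 hb
  refine ⟨hps, hp₁, ?_⟩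
  by_contra hh
  obtain ⟨j, hj, -⟩ := 𝔓.exists_mem_zone_of_not_hit p.2 hp₁ hh
  exact hz j hj

/-- **The landing point of a lid critical point of index `i` lies in `critY i`.** [cite: GayKirby2016, §4, Lemma 14] -/
theorem lamLift_mem_critY (hgM : IsMorse (𝓡 3) B.g) (hεT : 0 < 𝔉.εT) {i : ℕ} {p : T.H₂₃} (hp : p ∈ 𝔓.lidCrit hc2 i) :
    B.lamLift p.1 ∈ 𝔉.critY i := by
  letI := (T.bsliceAtlas hc2 𝔉.two_mul_ε_le 𝔉.linkCondition).chartedSpace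
  obtain ⟨hb, hz, hcrit, hidx⟩ := (𝔓.mem_lidCrit hc2).1 hp
  obtain ⟨hps, hp₁, hh⟩ := 𝔓.hit_of_not_mem_box hc2 hb hz
  obtain ⟨hcg, -⟩ := 𝔓.isMCriticalPt_g_of_isMCriticalPt_FH hc2 hps hh hz hcrit
  obtain ⟨hfc, hwε⟩ := 𝔓.f_eq_c_of_isMCriticalPt_FH hc2 hps hh hz hcrit
  obtain ⟨-, hidx'⟩ := 𝔓.nondegenerate_and_morseIndex_FH_eq_of_hit hc2 hgM hps hh hz hcrit
  refine ⟨⟨hcg, by rw [← hidx', hidx]⟩, ?_, fun j hj => ?_⟩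
  · -- `g(λ p) < b`: `G = -σ_ε(w) = -w ≤ -ε`
    have h0 : T.M p.1 = 0 := T.M_eq_zero_of_mem_H₂₃ p.2 hh
    have hM : T.M p.1 = B.gFun p.1 + creaseσ T.ε (T.w p.1) := rfl
    rw [creaseσ_of_le T.ε_pos hwε] at hM
    have hG : B.gFun p.1 = B.g (B.lamLift p.1) - B.b := rfl
    linarith [T.ε_pos]
  · -- `λ p` in a thin tube would be on the attaching circle, whose trajectories stay below `c`
    have hst := 𝔉.mem_stableSet_of_isMCriticalPt_of_mem_tubeNbhd hεT hj hcg
    have hy₀v : (B.lamLift p.1).1 = levelProj B.U.contMDiff B.f B.a p.1 := congrArg Subtype.val (B.lamLift_eq_of_hit hh)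
    obtain ⟨t₀, ht₀⟩ : ∃ t, flow B.U.contMDiff (B.lamLift p.1).1 t = p.1 := by
      rw [hy₀v]; exact mem_range_flow_levelProj B.U.contMDiff B.a p.1
    have hlt := 𝔉.f_flow_lt_c_of_mem_stableSet hst t₀
    rw [ht₀, hfc] at hlt
    exact lt_irrefl _ hlt

/-- **Every point of `critY i` is the landing point of a lid critical point of index `i`** (the
lid point of its trajectory: it lies in `H₂₃` since `g ≤ b - 2ε` at critical points below `b`,
off the box since `f = c`, and off the zones since its landing point is off the thin tubes).
[cite: GayKirby2016, §4, Lemma 14] -/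
theorem exists_mem_lidCrit_of_mem_critY (hgM : IsMorse (𝓡 3) B.g) {i : ℕ} {y : B.Y} (hy : y ∈ 𝔉.critY i) :
    ∃ p ∈ 𝔓.lidCrit hc2 i, B.lamLift p.1 = y := by
  letI := (T.bsliceAtlas hc2 𝔉.two_mul_ε_le 𝔉.linkCondition).chartedSpace
  obtain ⟨⟨hcg, hidx⟩, hgb, hnt⟩ := (𝔉.mem_critY).1 hy
  obtain ⟨t, ht⟩ := 𝔉.exists_f_flow_eq_c_of_mem_critY hy
  set x := B.U.fl y.1 t with hxdef
  have hfx : B.f x = T.c := ht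
  have hy0 : B.Hit y.1 := B.hit_of_apply_eq y.2
  have hh : B.Hit x := B.hit_fl hy0 t
  -- the landing point of `x` is `y`
  have hlam : B.lamLift x = y := by
    apply Subtype.ext
    show RegularLevel.incl B.hf (B.lamLift x) = y.1
    rw [B.incl_lamLift hh, hxdef, T.Fr.lam_fl hy0 t, T.Fr.lam_of_apply_eq y.2]
  -- `x ∉ X₁`, `x ∉ box`
  have hac := 𝔉.a_lt_c
  have hx₁ : x ∉ T.X₁ := fun h1 => by
    have hs := T.D.sFun_nonpos_of_mem_sector h1
    have hsdef : B.sFun x = B.f x - B.a := rfl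
    linarith
  have hxb : x ∉ B.box T.D.εw := fun hb => by
    have hs : |B.sFun x| < T.D.εw := hb.1
    have hsdef : B.sFun x = B.f x - B.a := rfl
    have := T.ε_le; have := T.ε_pos; have := T.D.εw_pos
    rw [hsdef, hfx] at hs
    linarith [(abs_lt.1 hs).2]
  -- `x ∈ H₂₃`: `G = g y - b ≤ -2ε`, so `M = G + σ_ε(-G) = 0`
  have hG : B.gFun x = B.g y - B.b := by
    show B.g (B.lamLift x) - B.b = _; rw [hlam]
  have hgap := 𝔉.critgap y hcg hgb
  have hM : T.M x = 0 := by
    have hMdef : T.M x = B.gFun x + creaseσ T.ε (B.f x - T.c - B.gFun x) := rfl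
    rw [hMdef, hfx, sub_self, zero_sub, creaseσ_of_le T.ε_pos (by rw [hG]; linarith)]
    ring
  have hH : x ∈ T.H₂₃ := by
    rw [T.mem_H₂₃_iff hc2 𝔉.two_mul_ε_le 𝔉.linkCondition]
    exact Or.inr (Or.inl ⟨hx₁, hh, hM⟩)
  -- `x` off the zones
  have hz : ∀ j, x ∉ 𝔓.zone j := fun j hj => by
    obtain ⟨hf₁, hf₂⟩ := 𝔓.band_of_mem_zone hj
    have h := 𝔉.lamLift_mem_tubeNbhd hj.1 (𝔓.P_lt_of_mem_zone hj) hf₁ hf₂ hh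
    rw [hlam] at h
    exact hnt j h
  have hps : x ∉ B.surface := fun hs => hxb (B.mem_box_of_mem_surface T.D.εw_pos hs)
  have hcg' : IsMCriticalPt (𝓡 3) B.g (B.lamLift x) := by rw [hlam]; exact hcg
  set p : T.H₂₃ := ⟨x, hH⟩ with hpdef
  have hcrit := 𝔓.isMCriticalPt_FH_of_isMCriticalPt_g hc2 (p := p) hps hh hz hcg' hfx
  obtain ⟨-, hidx'⟩ := 𝔓.nondegenerate_and_morseIndex_FH_eq_of_hit hc2 hgM (p := p) hps hh hz hcrit
  refine ⟨p, (𝔓.mem_lidCrit hc2).2 ⟨hxb, hz, hcrit, ?_⟩, hlam⟩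
  rw [hidx']
  show morseIndex (𝓡 3) B.g (B.lamLift x) = i
  rw [hlam]; exact hidx

/-- **The landing map is injective on the lid critical points** (two of them with the same
landing point lie on one trajectory and on the lid `f = c`; `f` increases strictly along the
trajectory). [cite: MilnorHCobordism1965, Thm. 4.1] -/
theorem lamLift_injOn (i i' : ℕ) {p p' : T.H₂₃} (hp : p ∈ 𝔓.lidCrit hc2 i) (hp' : p' ∈ 𝔓.lidCrit hc2 i')
    (h : B.lamLift p.1 = B.lamLift p'.1) : p = p' := by
  letI := (T.bsliceAtlas hc2 𝔉.two_mul_ε_le 𝔉.linkCondition).chartedSpace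
  obtain ⟨hb, hz, hcrit, -⟩ := (𝔓.mem_lidCrit hc2).1 hp
  obtain ⟨hb', hz', hcrit', -⟩ := (𝔓.mem_lidCrit hc2).1 hp'
  obtain ⟨hps, -, hh⟩ := 𝔓.hit_of_not_mem_box hc2 hb hz
  obtain ⟨hps', -, hh'⟩ := 𝔓.hit_of_not_mem_box hc2 hb' hz'
  obtain ⟨hfc, -⟩ := 𝔓.f_eq_c_of_isMCriticalPt_FH hc2 hps hh hz hcrit
  obtain ⟨hfc', -⟩ := 𝔓.f_eq_c_of_isMCriticalPt_FH hc2 hps' hh' hz' hcrit'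
  set y := B.lamLift p.1 with hy
  have hyv : y.1 = levelProj B.U.contMDiff B.f B.a p.1 := congrArg Subtype.val (B.lamLift_eq_of_hit hh)
  have hyv' : y.1 = levelProj B.U.contMDiff B.f B.a p'.1 := by
    have h1 := congrArg Subtype.val (B.lamLift_eq_of_hit hh')
    rw [← h] at h1
    exact h1
  obtain ⟨t, ht⟩ : ∃ t, flow B.U.contMDiff y.1 t = p.1 := by
    rw [hyv]; exact mem_range_flow_levelProj B.U.contMDiff B.a p.1
  obtain ⟨t', ht'⟩ : ∃ t, flow B.U.contMDiff y.1 t = p'.1 := by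
    rw [hyv']; exact mem_range_flow_levelProj B.U.contMDiff B.a p'.1
  have hyc : ¬ IsMCriticalPt (𝓡 4) B.f y.1 := B.not_isMCriticalPt_of_apply_eq_a y.2
  have hmono : StrictMono (B.f ∘ flow B.U.contMDiff y.1) :=
    T.Fr.isGradientLike.strictMono_comp_flow T.Fr.isMorse B.U.contMDiff hyc
  have htt : t = t' := hmono.injective (by
    show B.f (flow B.U.contMDiff y.1 t) = B.f (flow B.U.contMDiff y.1 t')
    rw [ht, ht', hfc, hfc'])
  apply Subtype.ext
  rw [← ht, ← ht', htt]

/-- **The number of lid critical points of index `i` is the number of critical points of `g` of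
index `i` below `b` off the thin tubes.** [cite: GayKirby2016, §4, Lemma 14] -/
theorem ncard_lidCrit_eq (hgM : IsMorse (𝓡 3) B.g) (hεT : 0 < 𝔉.εT) (i : ℕ) :
    (𝔓.lidCrit hc2 i).ncard = (𝔉.critY i).ncard := by
  have himage : (fun p : T.H₂₃ => B.lamLift p.1) '' 𝔓.lidCrit hc2 i = 𝔉.critY i := by
    ext y
    constructor
    · rintro ⟨p, hp, rfl⟩
      exact 𝔓.lamLift_mem_critY hc2 hgM hεT hp
    · intro hy
      obtain ⟨p, hp, hpy⟩ := 𝔓.exists_mem_lidCrit_of_mem_critY hc2 hgM hy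
      exact ⟨p, hp, hpy⟩
  have hinj : Set.InjOn (fun p : T.H₂₃ => B.lamLift p.1) (𝔓.lidCrit hc2 i) :=
    fun p hp p' hp' h => 𝔓.lamLift_injOn hc2 i i hp hp' h
  rw [← himage, hinj.ncard_image]

end BeltParams

end TubeFrame

end TriData

end BiCollar

end Literature.Topology.FourManifolds

end
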